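import Literature.AlgebraicGeometry.Motives.HodgeStructureExteriorAlgebraLefschetzInvolution
import Literature.AlgebraicGeometry.Motives.HodgeStructureDivisorClassesNumericalEquivalence
import HarnessLib

/-!
# Milne 1999, Prop. 5.7 and Thm. 5.9 on a polarized `ℚ`-Hodge structure: `*_L` and `∗` COMMUTE WITH THE BASE CHANGE `Θ`
# AND WITH THE LEFSCHETZ GROUP `S(H)(ℂ)`, an operator commuting with `S(H)(ℂ)` maps `D(A)` into `D(B)`, and "all elements of
# `ℚ[L, Λ]` are Lefschetz": `ℚ[e_E, *_L] ∋ ∗, Λ` preserves the `ℚ`-algebra of Lefschetz classes `ℚ[B¹] = (⋀_ℚ V)^{S(H)}`,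
# whence `∗Dᵖ = D^{g-p}` IN EVERY DEGREE

[topic AlgebraicGeometry/Motives]

Layer `Literature/AlgebraicGeometry/Motives`, lane `lit-hodgefound` (Track 2 foundations library; prover seat `lit-hodgefound-p34`,
generation 29, row g29-#6). THEOREMS ONLY (no `def`, no named fact, no instance, no notation; net debt `0`). Sequel of rows g29-#4
(`Motives/HodgeStructureExteriorAlgebraLefschetzInvolution`: `lefschetzStar ω g = *_L`, `hodgeStar ω g = ∗` on `ExteriorAlgebra K W`, their
string formulas and `Sp(ω)`-equivariance `IsSymplectic.map_lefschetzStar` / `map_hodgeStar`) and g29-#5, read through MILNE'S OWN ROAD to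
"`∗` preserves Lefschetz classes": the base change `Θ = toComplexAlg V : ⋀_ℚ V → ⋀_ℂ V_ℂ`, the Lefschetz group `S(H)(ℂ) =
Q.lefschetzGroupBaseChange ℂ`, Cor. 4.5 "`H^{2p}(A, ℚ)^{S(A)} = Dᵖ(A)`" (`Polarization.forall_lefschetzGroupBaseChange_map_toComplexAlg_eq_iff_mem_divisorClasses`)
and Thm. 3.2 / Cor. 4.5 "`H^{2*}(A, ℚ)^{S(A)} = ℚ[B¹]`" (`Polarization.setOf_forall_lefschetzGroupBaseChange_map_toComplexAlg_eq_eq_adjoin_hodgeClasses_two`)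
of the seat's generations 25–28.

## Sources, VERBATIM

J. S. Milne, *Lefschetz classes on abelian varieties*, Duke Math. J. **96** (1999) [Milne1999LefschetzClasses], p. 664: "A cohomological
correspondence `u ∈ H*(X × Y)` is said to be Lefschetz if it lies in the subalgebra `D_hom(X × Y)_k` of `H*(X × Y)`. PROPOSITION 5.7.
Let `A` and `B` be abelian varieties over `Ω`. A cohomological correspondence `u` between `A` and `B` is Lefschetz if and only if
`ū : H*(A) → H*(B)` commutes with the actions of `L(A × B)`. If `u` is Lefschetz, then `ū` maps `D(A)_k` into `D(B)_k`. […]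
COROLLARY 5.8. For any abelian variety `A` over `Ω`, the Künneth components of the diagonal are Lefschetz. Proof. The projection
operator `H*(A) → Hˢ(A)` commutes with the action of `L(A)`." — p. 664: "`∗x = Σ_{i ≥ s-d, 0} (-1)^{(s-2i)(s-2i+1)/2} L^{d-s+i} xᵢ`.
THEOREM 5.9. Let `A` be an abelian variety over `Ω`. The correspondences `Λ`, `ᶜΛ`, and `∗` between `A` and itself are all
Lefschetz." — p. 665: "Proof. It is known (e.g., Kleiman 1968, p367) that `Λ`, regarded as a map of cohomology groups, is inverse to
`L`. Since the latter is Lefschetz, it commutes with the action of `L(A)`, which implies that the same is true of `Λ`, which is therefore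
Lefschetz. Consequently, all elements of the `ℚ`-algebra `ℚ[L, Λ]` are Lefschetz. Since this algebra contains `ᶜΛ` and `∗` (Kleiman
1968, 1.4.4), this completes the proof."
Y. André, *Pour une théorie inconditionnelle des motifs*, Publ. Math. IHÉS **83** (1996) [Andre1996Motifs], §1.1 (p. 10): "`*_L x =
Σ L^{d-j+k} x_{j-2k}`, `*_H x = Σ (-1)^{(j-2k)(j-2k+1)/2} L^{d-j+k} x_{j-2k}`" (formulas with coefficients in `ℚ`, the same over every
coefficient field), Prop. 1.2 (p. 11): "Les sous-algèbres `Q_ν[L, *_L]`, `Q_ν[L, *_H]`, `Q_ν[L, *_L L *_L]`, `Q_ν[L, ᶜΛ]` de `End H(X)` sont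
égales et contiennent les projecteurs de Künneth."
H. Lange, *Abelian Varieties over the Complex Numbers* (2023) [Lange2023AbelianVarietiesComplex], §7.3.1–7.3.2 (p. 338: the Lefschetz
decomposition "(3) `⋀ᵏ V = Pᵏ ⊕ L P^{k-2} ⊕ ⋯`" is compatible with `⊗ ℂ` and with the action of `Sp(V, E)`).

## What is PROVED (`E = E_Q = Q.lefschetzClass`, `Θ = toComplexAlg V`, `S = Q.lefschetzGroupBaseChange ℂ`, `dim V = 2g`, `n` odd)

* §1 **BASE CHANGE — `IsSymplectic.toComplexAlg_lefschetzStar`, `IsSymplectic.toComplexAlg_hodgeStar`: `Θ (*_L x) = *_{L,ℂ} (Θ x)`,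
  `Θ (∗x) = ∗_ℂ (Θ x)`** for every symplectic `ω ∈ ⋀²_ℚ V` whose complexification `Θ ω` is symplectic of the same genus (both sides
  are `ℚ`-linear and agree on the strings `ωʲ ∧ p`, `p` primitive; the defining formulas have rational coefficients); on the carrier
  `Polarization.toComplexAlg_lefschetzStar` / `Polarization.toComplexAlg_hodgeStar` (`Θ E_Q` is symplectic: g28-#8).
* §2 **`S(H)(ℂ)`-EQUIVARIANCE of the complexified operators — `Polarization.map_lefschetzStar_eq_of_mem_lefschetzGroupBaseChange`,
  `Polarization.map_hodgeStar_eq_of_mem_lefschetzGroupBaseChange`, `Polarization.commute_map_of_mem_adjoin_lefschetzStar`**: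
  `⋀(γ) ∘ ∗_ℂ = ∗_ℂ ∘ ⋀(γ)` for `γ ∈ S(H)(ℂ)` ("`∗` commutes with the action of `L(A)`": `⋀(γ) Θ E = Θ E` by Cor. 4.5, then g29-#4);
  hence **`Polarization.forall_map_toComplexAlg_hodgeStar_eq`**: if `Θ x` is fixed by `S(H)(ℂ)` so is `Θ (∗x)` (and `Θ (*_L x)`).
* §3 **THM. 5.9 ON THE CARRIER — `Polarization.apply_mem_adjoin_hodgeClasses_two_of_mem_adjoin_lefschetzStar`: every `T` in the
  `ℚ`-algebra `ℚ[e_E, *_L] ⊆ End_ℚ(⋀ V)` (which contains `∗`, `Λ = lefschetzDual E g`, `*_L e_E *_L`, g29-#4) maps the `ℚ`-algebra of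
  Lefschetz classes `ℚ[B¹] = {x | Θ x is S(H)(ℂ)-invariant}` into itself** ("all elements of the `ℚ`-algebra `ℚ[L, Λ]` are Lefschetz");
  corollaries `Polarization.hodgeStar_apply_mem_adjoin_hodgeClasses_two` (`∗`), `Polarization.lefschetzStar_apply_mem_adjoin_hodgeClasses_two`
  (`*_L`), `Polarization.lefschetzDual_apply_mem_adjoin_hodgeClasses_two` (`Λ`, `g ≥ 1`).
* §4 **PROP. 5.7, OPERATOR FORM — `Polarization.apply_mem_map_divisorClasses_of_forall_lefschetzGroupBaseChange_comm`**: a `ℚ`-linear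
  `T` on `⋀_ℚ V` carrying `⋀^{2p}` into `⋀^{2q}` whose complexification `T_ℂ` (`Θ ∘ T = T_ℂ ∘ Θ` on `⋀^{2p}`) commutes with `S(H)(ℂ)` maps
  `Dᵖ` into `D^q` ("if `u` is Lefschetz, then `ū` maps `D(A)_k` into `D(B)_k`", with "Lefschetz ⟺ commutes with `L`"); the variant
  **`Polarization.apply_mem_map_divisorClasses_of_mem_adjoin_lefschetzStar`** for `T ∈ ℚ[e_E, *_L]`; and the instances
  **`Polarization.hodgeStar_apply_mem_map_divisorClasses_of_add_eq` (`∗Dᵖ ⊆ Dᵐ`, `p + m = g`, EVERY `p ≤ g`)**,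
  `Polarization.lefschetzStar_apply_mem_map_divisorClasses_of_add_eq` (`*_L Dᵖ ⊆ Dᵐ`), `Polarization.lefschetzDual_apply_mem_map_divisorClasses`
  (`Λ D^{p+1} ⊆ Dᵖ`), and the equality **`Polarization.map_hodgeStar_divisorClasses_eq_of_add_eq`: `∗Dᵖ = Dᵐ` for all `p + m = g`**
  (from the two inclusions and `∗² = 1` — no dimension count; g29-#5 proved it for `2p ≤ g` by hard Lefschetz and `d_p = d_{g-p}`).

## References

* [Milne1999LefschetzClasses] J. S. Milne, *Lefschetz classes on abelian varieties*, Duke Math. J. 96 (1999), §5 Prop. 5.7, Cor. 5.8,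
  Thm. 5.9 (pp. 664–665); §4 Cor. 4.5 (p. 659); §3 Thm. 3.2 (p. 653).
* [Andre1996Motifs] Y. André, *Pour une théorie inconditionnelle des motifs*, Publ. Math. IHÉS 83 (1996), §1.1 (p. 10), Prop. 1.2 (p. 11).
* [Lange2023AbelianVarietiesComplex] H. Lange, *Abelian Varieties over the Complex Numbers* (2023), §7.3.1, §7.3.2 (1)–(3) (p. 338).
* [Kleiman1968AlgebraicCycles] S. L. Kleiman, *Algebraic cycles and the Weil conjectures* (1968), §1.4, 1.4.4–1.4.6.
-/

noncomputable section

open scoped TensorProduct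

namespace Literature.AlgebraicGeometry.Motives

universe u

/-! ## §1 Base change `Θ : ⋀_ℚ V → ⋀_ℂ V_ℂ` of `*_L` and `∗` -/

namespace ExteriorLefschetz

open Literature.Algebra.Lie ExteriorAlgebra
open Literature.Algebra.Lie.HasLefschetzProperty (primitiveSpace mem_primitiveSpace_iff)

section BaseChange

variable {V : Type u} [AddCommGroup V] [Module ℚ V] {ω : ExteriorAlgebra ℚ V} {g : ℕ}

/-- The complexification of an abstract primitive vector of `(⋀_ℚ V, h, e_ω)` is primitive for `(⋀_ℂ V_ℂ, h, e_{Θω})` (weight `-k`,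
`k ≤ g`: `P_{-k} = P^{g-k}(ω)` and `Θ P^{g-k}(ω) ⊆ P^{g-k}(Θ ω)`). [cite: Lange2023AbelianVarietiesComplex, §7.3.2 (p. 338)] -/
theorem toComplexAlg_mem_primitiveSpace {k : ℕ} (hk : k ≤ g) {p : ExteriorAlgebra ℚ V}
    (hp : p ∈ primitiveSpace (shiftedDegree ℚ (fun i : ℕ ↦ ⋀[ℚ]^i V) g) (LinearMap.mul ℚ (ExteriorAlgebra ℚ V) ω) k) :
    toComplexAlg V p ∈ primitiveSpace (shiftedDegree ℂ (fun i : ℕ ↦ ⋀[ℂ]^i (ℂ ⊗[ℚ] V)) g)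
      (LinearMap.mul ℂ (ExteriorAlgebra ℂ (ℂ ⊗[ℚ] V)) (toComplexAlg V ω)) k := by
  rw [primitiveSpace_shiftedDegree_mul_eq_primitive _ g hk] at hp ⊢
  exact HodgeStructure.toComplexAlg_mem_primitive hp

/-- **`*_L` commutes with the base change `ℚ → ℂ`: `Θ (*_L x) = *_{L,ℂ} (Θ x)`** (`ω`, `Θ ω` symplectic of genus `g`): both sides are
`ℚ`-linear in `x` and agree on the strings `ωʲ ∧ p` (`p ∈ P_{-k}`, `j ≤ k`), where both equal `(Θω)^{k-j} ∧ Θp`.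
[cite: Andre1996Motifs, §1.1 (p. 10)] [cite: Lange2023AbelianVarietiesComplex, §7.3.2 (3) (p. 338)] -/
theorem IsSymplectic.toComplexAlg_lefschetzStar (hω : IsSymplectic ω g) (hωC : IsSymplectic (toComplexAlg V ω) g)
    (x : ExteriorAlgebra ℚ V) :
    toComplexAlg V (lefschetzStar ω g x) = lefschetzStar (toComplexAlg V ω) g (toComplexAlg V x) := by
  haveI := hω.finiteDimensional_exteriorAlgebra
  suffices h : (toComplexAlg V).toLinearMap ∘ₗ lefschetzStar ω g =
      ((lefschetzStar (toComplexAlg V ω) g).restrictScalars ℚ) ∘ₗ (toComplexAlg V).toLinearMap from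
    LinearMap.congr_fun h x
  refine hω.hasLefschetzProperty_mul.linearMap_ext_of_strings (isZGrading_shiftedDegree ℚ (fun i : ℕ ↦ ⋀[ℚ]^i V) g) ?_
  intro k p hp j hj
  rw [LinearMap.comp_apply, LinearMap.comp_apply, AlgHom.toLinearMap_apply, AlgHom.toLinearMap_apply,
    LinearMap.restrictScalars_apply]
  by_cases hk : k ≤ g
  · have key := (hωC.hasLefschetzProperty_mul.isStringReversal_lefschetzInvolution
      (isZGrading_shiftedDegree ℂ (fun i : ℕ ↦ ⋀[ℂ]^i (ℂ ⊗[ℚ] V)) g)) (toComplexAlg_mem_primitiveSpace hk hp) hj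
    rw [hω.lefschetzStar_eq, (hω.hasLefschetzProperty_mul.isStringReversal_lefschetzInvolution _) hp hj, mul_pow_eq_mul_pow,
      mul_pow_eq_mul_pow, LinearMap.mul_apply', LinearMap.mul_apply', map_mul, map_pow, map_mul, map_pow]
    rw [mul_pow_eq_mul_pow, mul_pow_eq_mul_pow, LinearMap.mul_apply', LinearMap.mul_apply', ← hωC.lefschetzStar_eq] at key
    exact key.symm
  · rw [primitiveSpace_shiftedDegree_mul_eq_bot ω g (not_le.1 hk), Submodule.mem_bot] at hp
    simp only [hp, map_zero]

/-- **`∗` commutes with the base change `ℚ → ℂ`: `Θ (∗x) = ∗_ℂ (Θ x)`** (`ω`, `Θ ω` symplectic of genus `g`; on a string both sides are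
`(-1)^{(g-k)(g-k+1)/2} (Θω)^{k-j} ∧ Θp`). [cite: Milne1999LefschetzClasses, §5 p. 664] [cite: Andre1996Motifs, §1.1 (p. 10)] -/
theorem IsSymplectic.toComplexAlg_hodgeStar (hω : IsSymplectic ω g) (hωC : IsSymplectic (toComplexAlg V ω) g)
    (x : ExteriorAlgebra ℚ V) :
    toComplexAlg V (hodgeStar ω g x) = hodgeStar (toComplexAlg V ω) g (toComplexAlg V x) := by
  haveI := hω.finiteDimensional_exteriorAlgebra
  haveI := hωC.finiteDimensional_exteriorAlgebra
  suffices h : (toComplexAlg V).toLinearMap ∘ₗ hodgeStar ω g =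
      ((hodgeStar (toComplexAlg V ω) g).restrictScalars ℚ) ∘ₗ (toComplexAlg V).toLinearMap from
    LinearMap.congr_fun h x
  refine hω.hasLefschetzProperty_mul.linearMap_ext_of_strings (isZGrading_shiftedDegree ℚ (fun i : ℕ ↦ ⋀[ℚ]^i V) g) ?_
  intro k p hp j hj
  rw [LinearMap.comp_apply, LinearMap.comp_apply, AlgHom.toLinearMap_apply, AlgHom.toLinearMap_apply,
    LinearMap.restrictScalars_apply]
  by_cases hk : k ≤ g
  · have key := hωC.hasLefschetzProperty_mul.hodgeInvolution_apply_pow_primitive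
      (isZGrading_shiftedDegree ℂ (fun i : ℕ ↦ ⋀[ℂ]^i (ℂ ⊗[ℚ] V)) g) g (toComplexAlg_mem_primitiveSpace hk hp) hj
    rw [hω.hodgeStar_eq, hω.hasLefschetzProperty_mul.hodgeInvolution_apply_pow_primitive _ g hp hj, map_smul, mul_pow_eq_mul_pow,
      mul_pow_eq_mul_pow, LinearMap.mul_apply', LinearMap.mul_apply', map_mul, map_pow, map_mul, map_pow,
      ← algebraMap_smul ℂ ((-1 : ℚ) ^ ((g - k) * (g - k + 1) / 2)), map_pow, map_neg, map_one]
    rw [mul_pow_eq_mul_pow, mul_pow_eq_mul_pow, LinearMap.mul_apply', LinearMap.mul_apply', ← hωC.hodgeStar_eq] at key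
    exact key.symm
  · rw [primitiveSpace_shiftedDegree_mul_eq_bot ω g (not_le.1 hk), Submodule.mem_bot] at hp
    simp only [hp, map_zero]

end BaseChange

end ExteriorLefschetz

namespace HodgeStructure

open ExteriorLefschetz ExteriorAlgebra

variable {V : Type u} [AddCommGroup V] [Module ℚ V] [Module.Finite ℚ V] {n : ℤ} {H : HodgeStructure V n}
  (Q : Polarization H) (hn : Odd n) {g : ℕ} (hg : Module.finrank ℚ V = 2 * g)

/-! ### §1 (carrier) `Θ ∘ *_L = *_{L,ℂ} ∘ Θ`, `Θ ∘ ∗ = ∗_ℂ ∘ Θ` for `E = E_Q` -/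

include hn hg in
/-- **`Θ (*_L x) = *_{L,ℂ} (Θ x)` for the Lefschetz class `E_Q`.** [cite: Andre1996Motifs, §1.1 (p. 10)]
[cite: Lange2023AbelianVarietiesComplex, §7.3.2 (p. 338)] -/
theorem Polarization.toComplexAlg_lefschetzStar (x : ExteriorAlgebra ℚ V) :
    toComplexAlg V (lefschetzStar (Q.lefschetzClass : ExteriorAlgebra ℚ V) g x) =
      lefschetzStar (toComplexAlg V (Q.lefschetzClass : ExteriorAlgebra ℚ V)) g (toComplexAlg V x) :=
  (Q.isSymplectic_lefschetzClass hn hg).toComplexAlg_lefschetzStar (Q.isSymplectic_toComplexAlg_lefschetzClass hn hg) x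

include hn hg in
/-- **`Θ (∗x) = ∗_ℂ (Θ x)` for the Lefschetz class `E_Q`** (Milne's `∗` is defined over the field of definition of the polarization
by a formula with rational signs on the Lefschetz components, which complexify to the Lefschetz components of `Θ x`).
[cite: Milne1999LefschetzClasses, §5 p. 664] [cite: Lange2023AbelianVarietiesComplex, §7.3.2 (3) (p. 338)] -/
theorem Polarization.toComplexAlg_hodgeStar (x : ExteriorAlgebra ℚ V) :
    toComplexAlg V (hodgeStar (Q.lefschetzClass : ExteriorAlgebra ℚ V) g x) =
      hodgeStar (toComplexAlg V (Q.lefschetzClass : ExteriorAlgebra ℚ V)) g (toComplexAlg V x) :=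
  (Q.isSymplectic_lefschetzClass hn hg).toComplexAlg_hodgeStar (Q.isSymplectic_toComplexAlg_lefschetzClass hn hg) x

/-! ## §2 `S(H)(ℂ)`-equivariance: "`∗` commutes with the action of `L(A)`" -/

include hn hg in
/-- **`⋀(γ) (*_{L,ℂ} X) = *_{L,ℂ} (⋀(γ) X)` for `γ ∈ S(H)(ℂ)`** (`⋀(γ) Θ E = Θ E` by Cor. 4.5, and g29-#4 `IsSymplectic.map_lefschetzStar`).
[cite: Milne1999LefschetzClasses, §5 Thm. 5.9 (proof, p. 665) and §4 Cor. 4.5] -/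
theorem Polarization.map_lefschetzStar_eq_of_mem_lefschetzGroupBaseChange {γ : (ℂ ⊗[ℚ] V) ≃ₗ[ℂ] (ℂ ⊗[ℚ] V)}
    (hγ : γ ∈ Q.lefschetzGroupBaseChange ℂ) (X : ExteriorAlgebra ℂ (ℂ ⊗[ℚ] V)) :
    ExteriorAlgebra.map (γ : ℂ ⊗[ℚ] V →ₗ[ℂ] ℂ ⊗[ℚ] V) (lefschetzStar (toComplexAlg V (Q.lefschetzClass : ExteriorAlgebra ℚ V)) g X) =
      lefschetzStar (toComplexAlg V (Q.lefschetzClass : ExteriorAlgebra ℚ V)) g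
        (ExteriorAlgebra.map (γ : ℂ ⊗[ℚ] V →ₗ[ℂ] ℂ ⊗[ℚ] V) X) :=
  (Q.isSymplectic_toComplexAlg_lefschetzClass hn hg).map_lefschetzStar _
    (Q.map_toComplexAlg_lefschetzClass_eq_of_mem_lefschetzGroupBaseChange hn hγ) X

include hn hg in
/-- **MILNE'S "`∗` commutes with the action of `L(A)`": `⋀(γ) (∗_ℂ X) = ∗_ℂ (⋀(γ) X)` for every `γ ∈ S(H)(ℂ)`.**
[cite: Milne1999LefschetzClasses, §5 Thm. 5.9 (pp. 664–665) and Prop. 5.7] -/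
theorem Polarization.map_hodgeStar_eq_of_mem_lefschetzGroupBaseChange {γ : (ℂ ⊗[ℚ] V) ≃ₗ[ℂ] (ℂ ⊗[ℚ] V)}
    (hγ : γ ∈ Q.lefschetzGroupBaseChange ℂ) (X : ExteriorAlgebra ℂ (ℂ ⊗[ℚ] V)) :
    ExteriorAlgebra.map (γ : ℂ ⊗[ℚ] V →ₗ[ℂ] ℂ ⊗[ℚ] V) (hodgeStar (toComplexAlg V (Q.lefschetzClass : ExteriorAlgebra ℚ V)) g X) =
      hodgeStar (toComplexAlg V (Q.lefschetzClass : ExteriorAlgebra ℚ V)) g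
        (ExteriorAlgebra.map (γ : ℂ ⊗[ℚ] V →ₗ[ℂ] ℂ ⊗[ℚ] V) X) :=
  (Q.isSymplectic_toComplexAlg_lefschetzClass hn hg).map_hodgeStar _
    (Q.map_toComplexAlg_lefschetzClass_eq_of_mem_lefschetzGroupBaseChange hn hγ) X

include hn hg in
/-- **Every element of `ℂ[e_{ΘE}, *_{L,ℂ}]` (`∋ Λ_ℂ, ᶜΛ_ℂ, ∗_ℂ`) commutes with `⋀(γ)`, `γ ∈ S(H)(ℂ)`** ("consequently, all elements of the
`ℚ`-algebra `ℚ[L, Λ]` are Lefschetz"). [cite: Milne1999LefschetzClasses, §5 Thm. 5.9 (proof, p. 665)] -/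
theorem Polarization.commute_map_of_mem_adjoin_lefschetzStar {γ : (ℂ ⊗[ℚ] V) ≃ₗ[ℂ] (ℂ ⊗[ℚ] V)}
    (hγ : γ ∈ Q.lefschetzGroupBaseChange ℂ) {T : Module.End ℂ (ExteriorAlgebra ℂ (ℂ ⊗[ℚ] V))}
    (hT : T ∈ Algebra.adjoin ℂ ({LinearMap.mul ℂ (ExteriorAlgebra ℂ (ℂ ⊗[ℚ] V)) (toComplexAlg V (Q.lefschetzClass : ExteriorAlgebra ℚ V)),
      lefschetzStar (toComplexAlg V (Q.lefschetzClass : ExteriorAlgebra ℚ V)) g} : Set (Module.End ℂ (ExteriorAlgebra ℂ (ℂ ⊗[ℚ] V))))) :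
    Commute (ExteriorAlgebra.map (γ : ℂ ⊗[ℚ] V →ₗ[ℂ] ℂ ⊗[ℚ] V)).toLinearMap T :=
  (Q.isSymplectic_toComplexAlg_lefschetzClass hn hg).commute_map_of_mem_adjoin _
    (Q.map_toComplexAlg_lefschetzClass_eq_of_mem_lefschetzGroupBaseChange hn hγ) hT

include hn hg in
/-- **If `Θ x` is fixed by `S(H)(ℂ)`, so is `Θ (*_L x)`.** [cite: Milne1999LefschetzClasses, §5 Thm. 5.9 (proof, p. 665)] -/
theorem Polarization.forall_map_toComplexAlg_lefschetzStar_eq {x : ExteriorAlgebra ℚ V}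
    (hx : ∀ γ ∈ Q.lefschetzGroupBaseChange ℂ,
      ExteriorAlgebra.map (γ : ℂ ⊗[ℚ] V →ₗ[ℂ] ℂ ⊗[ℚ] V) (toComplexAlg V x) = toComplexAlg V x) :
    ∀ γ ∈ Q.lefschetzGroupBaseChange ℂ,
      ExteriorAlgebra.map (γ : ℂ ⊗[ℚ] V →ₗ[ℂ] ℂ ⊗[ℚ] V)
          (toComplexAlg V (lefschetzStar (Q.lefschetzClass : ExteriorAlgebra ℚ V) g x)) =
        toComplexAlg V (lefschetzStar (Q.lefschetzClass : ExteriorAlgebra ℚ V) g x) := fun γ hγ ↦ by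
  rw [Q.toComplexAlg_lefschetzStar hn hg, Q.map_lefschetzStar_eq_of_mem_lefschetzGroupBaseChange hn hg hγ, hx γ hγ]

include hn hg in
/-- **If `Θ x` is fixed by `S(H)(ℂ)`, so is `Θ (∗x)`** — `∗` "commutes with the actions of `L`", the hypothesis of Prop. 5.7.
[cite: Milne1999LefschetzClasses, §5 Prop. 5.7 and Thm. 5.9 (pp. 664–665)] -/
theorem Polarization.forall_map_toComplexAlg_hodgeStar_eq {x : ExteriorAlgebra ℚ V}
    (hx : ∀ γ ∈ Q.lefschetzGroupBaseChange ℂ,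
      ExteriorAlgebra.map (γ : ℂ ⊗[ℚ] V →ₗ[ℂ] ℂ ⊗[ℚ] V) (toComplexAlg V x) = toComplexAlg V x) :
    ∀ γ ∈ Q.lefschetzGroupBaseChange ℂ,
      ExteriorAlgebra.map (γ : ℂ ⊗[ℚ] V →ₗ[ℂ] ℂ ⊗[ℚ] V)
          (toComplexAlg V (hodgeStar (Q.lefschetzClass : ExteriorAlgebra ℚ V) g x)) =
        toComplexAlg V (hodgeStar (Q.lefschetzClass : ExteriorAlgebra ℚ V) g x) := fun γ hγ ↦ by
  rw [Q.toComplexAlg_hodgeStar hn hg, Q.map_hodgeStar_eq_of_mem_lefschetzGroupBaseChange hn hg hγ, hx γ hγ]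

/-! ## §3 Thm. 5.9 on the carrier: `ℚ[e_E, *_L]` preserves the `ℚ`-algebra of Lefschetz classes `ℚ[B¹] = (⋀_ℚ V)^{S(H)(ℂ)}` -/

include hn in
/-- `x ∈ ℚ[B¹]` iff `Θ x` is `S(H)(ℂ)`-invariant (the tree's Thm. 3.2 / Cor. 4.5, membership form). [cite: Milne1999LefschetzClasses, §3 Thm. 3.2 and §4 Cor. 4.5] -/
private theorem Polarization.mem_adjoin_hodgeClasses_two_iff (x : ExteriorAlgebra ℚ V) :
    x ∈ Algebra.adjoin ℚ (((H.exteriorPower 2).hodgeClasses n).map (⋀[ℚ]^2 V).subtype : Set (ExteriorAlgebra ℚ V)) ↔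
      ∀ γ ∈ Q.lefschetzGroupBaseChange ℂ,
        ExteriorAlgebra.map (γ : ℂ ⊗[ℚ] V →ₗ[ℂ] ℂ ⊗[ℚ] V) (toComplexAlg V x) = toComplexAlg V x := by
  have h := Q.setOf_forall_lefschetzGroupBaseChange_map_toComplexAlg_eq_eq_adjoin_hodgeClasses_two hn
  rw [Set.ext_iff] at h
  exact ((h x).trans Iff.rfl).symm

include hn hg in
/-- **MILNE 1999, THM. 5.9 ON THE CARRIER — "all elements of the `ℚ`-algebra `ℚ[L, Λ]` are Lefschetz"**: every `T ∈ ℚ[e_E, *_L]`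
(`= ℚ[L, Λ]`, containing `∗`, `Λ`, `ᶜΛ`; g29-#4) maps the `ℚ`-algebra `ℚ[B¹] ⊆ ⋀_ℚ V` generated by the degree-two Hodge classes — the
rational classes with `S(H)(ℂ)`-invariant complexification, `= ⨁_p Dᵖ` — into itself (`e_E` is multiplication by `E ∈ B¹`; `*_L`
commutes with `Θ` and with `⋀(γ)`, `γ ∈ S(H)(ℂ)`). [cite: Milne1999LefschetzClasses, §5 Thm. 5.9 (pp. 664–665)]
[cite: Milne1999LefschetzClasses, §4 Cor. 4.5 (p. 659)] -/
theorem Polarization.apply_mem_adjoin_hodgeClasses_two_of_mem_adjoin_lefschetzStar {T : Module.End ℚ (ExteriorAlgebra ℚ V)}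
    (hT : T ∈ Algebra.adjoin ℚ ({LinearMap.mul ℚ (ExteriorAlgebra ℚ V) (Q.lefschetzClass : ExteriorAlgebra ℚ V),
      lefschetzStar (Q.lefschetzClass : ExteriorAlgebra ℚ V) g} : Set (Module.End ℚ (ExteriorAlgebra ℚ V))))
    {x : ExteriorAlgebra ℚ V}
    (hx : x ∈ Algebra.adjoin ℚ (((H.exteriorPower 2).hodgeClasses n).map (⋀[ℚ]^2 V).subtype : Set (ExteriorAlgebra ℚ V))) :
    T x ∈ Algebra.adjoin ℚ (((H.exteriorPower 2).hodgeClasses n).map (⋀[ℚ]^2 V).subtype : Set (ExteriorAlgebra ℚ V)) := by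
  induction hT using Algebra.adjoin_induction generalizing x with
  | mem T hT =>
    rw [Set.mem_insert_iff, Set.mem_singleton_iff] at hT
    rcases hT with rfl | rfl
    · rw [LinearMap.mul_apply']
      exact Subalgebra.mul_mem _ (Algebra.subset_adjoin ⟨Q.lefschetzClass, Q.lefschetzClass_mem_hodgeClasses, rfl⟩) hx
    · rw [Q.mem_adjoin_hodgeClasses_two_iff hn] at hx ⊢
      exact Q.forall_map_toComplexAlg_lefschetzStar_eq hn hg hx
  | algebraMap r =>
    rw [Module.algebraMap_end_apply]
    exact Subalgebra.smul_mem _ hx r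
  | add S T _ _ hS hT =>
    rw [LinearMap.add_apply]
    exact add_mem (hS hx) (hT hx)
  | mul S T _ _ hS hT =>
    rw [Module.End.mul_apply]
    exact hS (hT hx)

include hn hg in
/-- **`∗` is Lefschetz: `∗ ℚ[B¹] ⊆ ℚ[B¹]`** (`∗ ∈ ℚ[e_E, *_L]`, g29-#4 `IsSymplectic.hodgeStar_mem_adjoin_lefschetzStar`).
[cite: Milne1999LefschetzClasses, §5 Thm. 5.9 (pp. 664–665)] -/
theorem Polarization.hodgeStar_apply_mem_adjoin_hodgeClasses_two {x : ExteriorAlgebra ℚ V}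
    (hx : x ∈ Algebra.adjoin ℚ (((H.exteriorPower 2).hodgeClasses n).map (⋀[ℚ]^2 V).subtype : Set (ExteriorAlgebra ℚ V))) :
    hodgeStar (Q.lefschetzClass : ExteriorAlgebra ℚ V) g x ∈
      Algebra.adjoin ℚ (((H.exteriorPower 2).hodgeClasses n).map (⋀[ℚ]^2 V).subtype : Set (ExteriorAlgebra ℚ V)) :=
  Q.apply_mem_adjoin_hodgeClasses_two_of_mem_adjoin_lefschetzStar hn hg
    ((Q.isSymplectic_lefschetzClass hn hg).hodgeStar_mem_adjoin_lefschetzStar) hx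

include hn hg in
/-- **`*_L` is Lefschetz: `*_L ℚ[B¹] ⊆ ℚ[B¹]`.** [cite: Milne1999LefschetzClasses, §5 Thm. 5.9 (p. 665: "`L` […] or its inverse")] [cite: Andre1996Motifs, §1.1 (p. 10)] -/
theorem Polarization.lefschetzStar_apply_mem_adjoin_hodgeClasses_two {x : ExteriorAlgebra ℚ V}
    (hx : x ∈ Algebra.adjoin ℚ (((H.exteriorPower 2).hodgeClasses n).map (⋀[ℚ]^2 V).subtype : Set (ExteriorAlgebra ℚ V))) :
    lefschetzStar (Q.lefschetzClass : ExteriorAlgebra ℚ V) g x ∈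
      Algebra.adjoin ℚ (((H.exteriorPower 2).hodgeClasses n).map (⋀[ℚ]^2 V).subtype : Set (ExteriorAlgebra ℚ V)) :=
  Q.apply_mem_adjoin_hodgeClasses_two_of_mem_adjoin_lefschetzStar hn hg (Algebra.subset_adjoin (Set.mem_insert_of_mem _ rfl)) hx

include hn hg in
/-- **`Λ` is Lefschetz: `Λ ℚ[B¹] ⊆ ℚ[B¹]`** (`Λ = lefschetzDual E g ∈ ℚ[e_E, *_L]`, g29-#4; `g ≥ 1`). [cite: Milne1999LefschetzClasses, §5 Thm. 5.9 (pp. 664–665)] -/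
theorem Polarization.lefschetzDual_apply_mem_adjoin_hodgeClasses_two (hg0 : 0 < g) {x : ExteriorAlgebra ℚ V}
    (hx : x ∈ Algebra.adjoin ℚ (((H.exteriorPower 2).hodgeClasses n).map (⋀[ℚ]^2 V).subtype : Set (ExteriorAlgebra ℚ V))) :
    lefschetzDual (Q.lefschetzClass : ExteriorAlgebra ℚ V) g x ∈
      Algebra.adjoin ℚ (((H.exteriorPower 2).hodgeClasses n).map (⋀[ℚ]^2 V).subtype : Set (ExteriorAlgebra ℚ V)) :=
  Q.apply_mem_adjoin_hodgeClasses_two_of_mem_adjoin_lefschetzStar hn hg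
    ((Q.isSymplectic_lefschetzClass hn hg).lefschetzDual_mem_adjoin_lefschetzStar hg0) hx

/-! ## §4 Prop. 5.7, operator form: an operator commuting with `S(H)(ℂ)` maps `Dᵖ` into `D^q`; `∗Dᵖ = D^{g-p}` in every degree -/

include hn in
/-- **MILNE 1999, PROP. 5.7, OPERATOR FORM ON THE CARRIER — "if `u` is Lefschetz, then `ū` maps `D(A)_k` into `D(B)_k`"** (with "Lefschetz
⟺ `ū` commutes with the actions of `L`"): a `ℚ`-linear operator `T` of `⋀_ℚ V` carrying `⋀^{2p}` into `⋀^{2q}`, with a complexification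
`T_ℂ` (`Θ (T y) = T_ℂ (Θ y)` on `⋀^{2p}`) commuting with `⋀(γ)` for all `γ ∈ S(H)(ℂ)`, maps `Dᵖ` into `D^q`: `Θ (T x) = T_ℂ (Θ x)` is fixed
by `S(H)(ℂ)` when `Θ x` is, and "fixed by `S(H)(ℂ)` ⟺ divisor class" (Cor. 4.5). [cite: Milne1999LefschetzClasses, §5 Prop. 5.7 (p. 664)]
[cite: Milne1999LefschetzClasses, §4 Cor. 4.5 (p. 659)] -/
theorem Polarization.apply_mem_map_divisorClasses_of_forall_lefschetzGroupBaseChange_comm {p q : ℕ}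
    {T : Module.End ℚ (ExteriorAlgebra ℚ V)} (hTdeg : ∀ y ∈ ⋀[ℚ]^(2 * p) V, T y ∈ ⋀[ℚ]^(2 * q) V)
    {TC : Module.End ℂ (ExteriorAlgebra ℂ (ℂ ⊗[ℚ] V))} (hT : ∀ y ∈ ⋀[ℚ]^(2 * p) V, toComplexAlg V (T y) = TC (toComplexAlg V y))
    (hTC : ∀ γ ∈ Q.lefschetzGroupBaseChange ℂ, ∀ X : ExteriorAlgebra ℂ (ℂ ⊗[ℚ] V),
      ExteriorAlgebra.map (γ : ℂ ⊗[ℚ] V →ₗ[ℂ] ℂ ⊗[ℚ] V) (TC X) = TC (ExteriorAlgebra.map (γ : ℂ ⊗[ℚ] V →ₗ[ℂ] ℂ ⊗[ℚ] V) X))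
    {x : ExteriorAlgebra ℚ V} (hx : x ∈ (H.divisorClasses p).map (⋀[ℚ]^(2 * p) V).subtype) :
    T x ∈ (H.divisorClasses q).map (⋀[ℚ]^(2 * q) V).subtype := by
  obtain ⟨x, hx, rfl⟩ := hx
  refine ⟨⟨T x, hTdeg x x.2⟩, ?_, rfl⟩
  refine (Q.forall_lefschetzGroupBaseChange_map_toComplexAlg_eq_iff_mem_divisorClasses hn _).1 fun γ hγ ↦ ?_
  rw [Submodule.coe_mk, hT _ x.2, hTC γ hγ,
    (Q.forall_lefschetzGroupBaseChange_map_toComplexAlg_eq_iff_mem_divisorClasses hn x).2 hx γ hγ]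

include hn in
/-- **Prop. 5.7 for the elements `x ∈ Dᵖ` themselves** (the same statement with `T` given on `⋀^{2p}` and valued in `⋀^{2q}`).
[cite: Milne1999LefschetzClasses, §5 Prop. 5.7 (p. 664)] -/
theorem Polarization.apply_mem_divisorClasses_of_forall_lefschetzGroupBaseChange_comm {p q : ℕ}
    (T : ⋀[ℚ]^(2 * p) V →ₗ[ℚ] ⋀[ℚ]^(2 * q) V) {TC : Module.End ℂ (ExteriorAlgebra ℂ (ℂ ⊗[ℚ] V))}
    (hT : ∀ y : ⋀[ℚ]^(2 * p) V, toComplexAlg V ((T y : ⋀[ℚ]^(2 * q) V) : ExteriorAlgebra ℚ V) = TC (toComplexAlg V (y : ExteriorAlgebra ℚ V)))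
    (hTC : ∀ γ ∈ Q.lefschetzGroupBaseChange ℂ, ∀ X : ExteriorAlgebra ℂ (ℂ ⊗[ℚ] V),
      ExteriorAlgebra.map (γ : ℂ ⊗[ℚ] V →ₗ[ℂ] ℂ ⊗[ℚ] V) (TC X) = TC (ExteriorAlgebra.map (γ : ℂ ⊗[ℚ] V →ₗ[ℂ] ℂ ⊗[ℚ] V) X))
    {x : ⋀[ℚ]^(2 * p) V} (hx : x ∈ H.divisorClasses p) : T x ∈ H.divisorClasses q :=
  (Q.forall_lefschetzGroupBaseChange_map_toComplexAlg_eq_iff_mem_divisorClasses hn (T x)).1 fun γ hγ ↦ by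
    rw [hT, hTC γ hγ, (Q.forall_lefschetzGroupBaseChange_map_toComplexAlg_eq_iff_mem_divisorClasses hn x).2 hx γ hγ]

include hn hg in
/-- **Prop. 5.7 for `T ∈ ℚ[e_E, *_L]`**: an element of `ℚ[L, *_L] = ℚ[L, Λ]` carrying `⋀^{2p}` into `⋀^{2q}` maps `Dᵖ` into `D^q`
(Thm. 5.9: `T ℚ[B¹] ⊆ ℚ[B¹]`, and `ℚ[B¹] ∩ ⋀^{2q} = D^q`). [cite: Milne1999LefschetzClasses, §5 Prop. 5.7 and Thm. 5.9 (pp. 664–665)] -/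
theorem Polarization.apply_mem_map_divisorClasses_of_mem_adjoin_lefschetzStar {p q : ℕ} {T : Module.End ℚ (ExteriorAlgebra ℚ V)}
    (hT : T ∈ Algebra.adjoin ℚ ({LinearMap.mul ℚ (ExteriorAlgebra ℚ V) (Q.lefschetzClass : ExteriorAlgebra ℚ V),
      lefschetzStar (Q.lefschetzClass : ExteriorAlgebra ℚ V) g} : Set (Module.End ℚ (ExteriorAlgebra ℚ V))))
    (hTdeg : ∀ y ∈ ⋀[ℚ]^(2 * p) V, T y ∈ ⋀[ℚ]^(2 * q) V)
    {x : ExteriorAlgebra ℚ V} (hx : x ∈ (H.divisorClasses p).map (⋀[ℚ]^(2 * p) V).subtype) :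
    T x ∈ (H.divisorClasses q).map (⋀[ℚ]^(2 * q) V).subtype := by
  obtain ⟨x, hx, rfl⟩ := hx
  have hx' : (x : ExteriorAlgebra ℚ V) ∈
      Algebra.adjoin ℚ (((H.exteriorPower 2).hodgeClasses n).map (⋀[ℚ]^2 V).subtype : Set (ExteriorAlgebra ℚ V)) := by
    rw [Q.mem_adjoin_hodgeClasses_two_iff hn]
    exact (Q.forall_lefschetzGroupBaseChange_map_toComplexAlg_eq_iff_mem_divisorClasses hn x).2 hx
  have hTx := Q.apply_mem_adjoin_hodgeClasses_two_of_mem_adjoin_lefschetzStar hn hg hT hx'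
  rw [Q.mem_adjoin_hodgeClasses_two_iff hn] at hTx
  have h : T x ∈ {y : ExteriorAlgebra ℚ V | y ∈ ⋀[ℚ]^(2 * q) V ∧ ∀ γ ∈ Q.lefschetzGroupBaseChange ℂ,
      ExteriorAlgebra.map (γ : ℂ ⊗[ℚ] V →ₗ[ℂ] ℂ ⊗[ℚ] V) (toComplexAlg V y) = toComplexAlg V y} :=
    ⟨hTdeg x x.2, hTx⟩
  rw [Q.setOf_mem_and_forall_lefschetzGroupBaseChange_map_toComplexAlg_eq_eq_map_divisorClasses hn q] at h
  exact h

include hn hg in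
/-- **`∗Dᵖ ⊆ Dᵐ` for ALL `p + m = g`** — Milne's road: `∗` is Lefschetz (Thm. 5.9), hence maps `D(A)` into `D(A)` (Prop. 5.7), and
`∗ ⋀^{2p} ⊆ ⋀^{2g-2p}`. [cite: Milne1999LefschetzClasses, §5 Prop. 5.7 and Thm. 5.9 (pp. 664–665)] -/
theorem Polarization.hodgeStar_apply_mem_map_divisorClasses_of_add_eq {p m : ℕ} (hpm : p + m = g) {x : ExteriorAlgebra ℚ V}
    (hx : x ∈ (H.divisorClasses p).map (⋀[ℚ]^(2 * p) V).subtype) :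
    hodgeStar (Q.lefschetzClass : ExteriorAlgebra ℚ V) g x ∈ (H.divisorClasses m).map (⋀[ℚ]^(2 * m) V).subtype :=
  Q.apply_mem_map_divisorClasses_of_mem_adjoin_lefschetzStar hn hg ((Q.isSymplectic_lefschetzClass hn hg).hodgeStar_mem_adjoin_lefschetzStar)
    (fun _ hy ↦ (Q.isSymplectic_lefschetzClass hn hg).hodgeStar_apply_mem (by omega) hy) hx

include hn hg in
/-- **`*_L Dᵖ ⊆ Dᵐ` for all `p + m = g`.** [cite: Milne1999LefschetzClasses, §5 Thm. 5.9 (p. 665)] [cite: Andre1996Motifs, §1.1 (p. 10)] -/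
theorem Polarization.lefschetzStar_apply_mem_map_divisorClasses_of_add_eq {p m : ℕ} (hpm : p + m = g) {x : ExteriorAlgebra ℚ V}
    (hx : x ∈ (H.divisorClasses p).map (⋀[ℚ]^(2 * p) V).subtype) :
    lefschetzStar (Q.lefschetzClass : ExteriorAlgebra ℚ V) g x ∈ (H.divisorClasses m).map (⋀[ℚ]^(2 * m) V).subtype :=
  Q.apply_mem_map_divisorClasses_of_mem_adjoin_lefschetzStar hn hg (Algebra.subset_adjoin (Set.mem_insert_of_mem _ rfl))
    (fun _ hy ↦ (Q.isSymplectic_lefschetzClass hn hg).lefschetzStar_apply_mem (by omega) hy) hx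

include hn hg in
/-- **`Λ D^{p+1} ⊆ Dᵖ`** ("`Λ` […] is therefore Lefschetz"; `g ≥ 1`). [cite: Milne1999LefschetzClasses, §5 Thm. 5.9 (pp. 664–665)] -/
theorem Polarization.lefschetzDual_apply_mem_map_divisorClasses (hg0 : 0 < g) {p : ℕ} {x : ExteriorAlgebra ℚ V}
    (hx : x ∈ (H.divisorClasses (p + 1)).map (⋀[ℚ]^(2 * (p + 1)) V).subtype) :
    lefschetzDual (Q.lefschetzClass : ExteriorAlgebra ℚ V) g x ∈ (H.divisorClasses p).map (⋀[ℚ]^(2 * p) V).subtype :=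
  Q.apply_mem_map_divisorClasses_of_mem_adjoin_lefschetzStar hn hg
    ((Q.isSymplectic_lefschetzClass hn hg).lefschetzDual_mem_adjoin_lefschetzStar hg0)
    (fun _ hy ↦ by simpa only [show 2 * (p + 1) - 2 = 2 * p by omega] using lefschetzDual_apply_mem _ g hy) hx

include hn hg in
/-- **`∗Dᵖ = Dᵐ` for ALL `p + m = g`** (as sub-spaces of `⋀_ℚ V`): both inclusions `∗Dᵖ ⊆ Dᵐ`, `∗Dᵐ ⊆ Dᵖ` and `∗² = 1`.
[cite: Milne1999LefschetzClasses, §5 Prop. 5.7 and Thm. 5.9 (pp. 664–665)] -/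
theorem Polarization.map_hodgeStar_divisorClasses_eq_of_add_eq {p m : ℕ} (hpm : p + m = g) :
    (H.divisorClasses p).map (hodgeStar (Q.lefschetzClass : ExteriorAlgebra ℚ V) g ∘ₗ (⋀[ℚ]^(2 * p) V).subtype) =
      (H.divisorClasses m).map (⋀[ℚ]^(2 * m) V).subtype := by
  refine le_antisymm ?_ fun y hy ↦ ?_
  · rintro _ ⟨x, hx, rfl⟩
    exact Q.hodgeStar_apply_mem_map_divisorClasses_of_add_eq hn hg hpm ⟨x, hx, rfl⟩
  · obtain ⟨z, hz, hzy⟩ := Q.hodgeStar_apply_mem_map_divisorClasses_of_add_eq hn hg (p := m) (m := p) (by omega) hy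
    refine ⟨z, hz, ?_⟩
    rw [LinearMap.comp_apply, hzy, ← Module.End.mul_apply, (Q.isSymplectic_lefschetzClass hn hg).hodgeStar_mul_self,
      Module.End.one_apply]

end HodgeStructure

end Literature.AlgebraicGeometry.Motives
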